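import Summits.CriticalPhenomena.Ising3DConformalLimit.Theses.EnergyNotSigmaSquared

/-!
# A Euclidean reflection is a word in unit inversions: `R_{m^⊥} = ι_m ∘ ι_{m/2,1/2} ∘ ι_m`

Pure Euclidean geometry in `ℝ³` (no Ising input), for the standing disprover of the crux
`…Theses.EnergyNotSigmaSquared.MoebiusLimit` (item stmt-CriticalPhenomena-1344): the reflection
in the plane `m^⊥` through the origin (`m` a unit vector) is the composite of the inversion in the
unit sphere centred at `m`, the inversion in the sphere of radius `1/2` centred at `m/2` (the image of
the plane under the first inversion), and the first inversion again:
`reflection_eq_inversion_word : y − 2⟪y,m⟫m = ι_m (ι_{m/2,1/2} (ι_m y))` for `y ∉ {m, −m}`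
(the two poles). Also the facts that the intermediate points avoid the next centre
(`inversion_unit_ne_half`, `inversion_half_ne_center`). This is the geometric input for deriving
rotation invariance of a scaling limit from inversion covariance and (free) translation invariance
(`Negative/RotationFromInversion.lean`): reflections in planes generate `O(3)`.
-/

noncomputable section

namespace Summit.CriticalPhenomena.Ising3DConformalLimit.MoebiusLimitExistsNegative

open EuclideanGeometry RealInnerProductSpace
open scoped RealInnerProductSpace

/-- The inversion formula in a normed space: `ι_{c,R}(z) = c + (R²/‖z−c‖²)·(z − c)`. [folklore] -/
theorem inversion_eq_center_add (c : EuclideanSpace ℝ (Fin 3)) (R : ℝ) (z : EuclideanSpace ℝ (Fin 3)) :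
    inversion c R z = c + (R ^ 2 / ‖z - c‖ ^ 2) • (z - c) := by
  rw [inversion, dist_eq_norm, vsub_eq_sub, vadd_eq_add, div_pow, add_comm]

/-- Norm of a combination of a unit vector and an orthogonal vector:
`‖α m + β w‖² = α² + β²‖w‖²`. [folklore] -/
theorem norm_sq_lincomb {m w : EuclideanSpace ℝ (Fin 3)} (hm : ‖m‖ = 1) (hmw : ⟪m, w⟫ = 0)
    (α β : ℝ) : ‖α • m + β • w‖ ^ 2 = α ^ 2 + β ^ 2 * ‖w‖ ^ 2 := by
  rw [norm_add_sq_real, norm_smul, norm_smul, real_inner_smul_left, real_inner_smul_right, hmw, hm,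
    Real.norm_eq_abs, Real.norm_eq_abs, mul_one, mul_pow, sq_abs, sq_abs]
  ring

/-- `ι_m(m/2) = −m` for a unit vector `m`. [folklore] -/
theorem inversion_unit_half {m : EuclideanSpace ℝ (Fin 3)} (hm : ‖m‖ = 1) :
    inversion m 1 ((1 / 2 : ℝ) • m) = -m := by
  rw [inversion_eq_center_add]
  have hs : (1 / 2 : ℝ) • m - m = ((1 / 2 : ℝ) - 1) • m := by rw [sub_smul, one_smul]
  rw [hs, norm_smul, Real.norm_eq_abs, hm, mul_one]
  match_scalars
  norm_num

/-- The first intermediate point avoids the second centre: `ι_m(y) ≠ m/2` for `y ≠ −m`. [folklore] -/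
theorem inversion_unit_ne_half {m y : EuclideanSpace ℝ (Fin 3)} (hm : ‖m‖ = 1) (hy : y ≠ -m) :
    inversion m 1 y ≠ (1 / 2 : ℝ) • m := by
  intro h
  have := congrArg (inversion m 1) h
  rw [inversion_inversion m one_ne_zero, inversion_unit_half hm] at this
  exact hy this

/-- The second intermediate point avoids the third centre: `ι_{m/2,1/2}(ι_m y) ≠ m` for `y ≠ m`.
[folklore] -/
theorem inversion_half_ne_center {m y : EuclideanSpace ℝ (Fin 3)} (hm : ‖m‖ = 1) (hy : y ≠ m) :
    inversion ((1 / 2 : ℝ) • m) (1 / 2) (inversion m 1 y) ≠ m := by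
  intro h
  have hmem : m ∈ Metric.sphere ((1 / 2 : ℝ) • m) (1 / 2) := by
    rw [Metric.mem_sphere, dist_eq_norm]
    have : m - (1 / 2 : ℝ) • m = (1 / 2 : ℝ) • m := by
      rw [sub_eq_iff_eq_add, ← add_smul]; norm_num
    rw [this, norm_smul, hm, Real.norm_eq_abs]; norm_num
  have := congrArg (inversion ((1 / 2 : ℝ) • m) (1 / 2)) h
  rw [inversion_inversion _ (by norm_num), inversion_of_mem_sphere hmem] at this
  exact hy ((inversion_eq_center one_ne_zero).1 this)

/-- **A reflection is a word in inversions**: for a unit vector `m` and `y ∉ {m, −m}`,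
`y − 2⟪y,m⟫ m = ι_m (ι_{m/2,1/2} (ι_m y))`. The computation runs in the plane spanned by `m` and
the component `w` of `y` orthogonal to `m`. [folklore] -/
theorem reflection_eq_inversion_word {m y : EuclideanSpace ℝ (Fin 3)} (hm : ‖m‖ = 1)
    (hy1 : y ≠ m) (hy2 : y ≠ -m) :
    y - (2 * ⟪y, m⟫) • m = inversion m 1 (inversion ((1 / 2 : ℝ) • m) (1 / 2) (inversion m 1 y)) := by
  -- coordinates: `y = a m + w`, `w ⊥ m`, `t = ‖w‖²`
  set a : ℝ := ⟪y, m⟫ with ha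
  set w : EuclideanSpace ℝ (Fin 3) := y - a • m with hw
  have hy : y = a • m + w := by rw [hw]; abel
  have hmm : ⟪m, m⟫ = 1 := by rw [real_inner_self_eq_norm_sq, hm]; norm_num
  have hmw : ⟪m, w⟫ = 0 := by
    rw [hw, inner_sub_right, real_inner_smul_right, hmm, real_inner_comm, ← ha]; ring
  set t : ℝ := ‖w‖ ^ 2 with ht
  -- the scalars of the computation
  set D₁ : ℝ := (a - 1) ^ 2 + t with hD₁
  set A₂ : ℝ := D₁ + 2 * (a - 1) with hA₂
  set N₂ : ℝ := A₂ ^ 2 + 4 * t with hN₂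
  set A₃ : ℝ := A₂ * D₁ - N₂ with hA₃
  set N₃ : ℝ := A₃ ^ 2 + 4 * D₁ ^ 2 * t with hN₃
  have key1 : 4 * D₁ * N₂ = N₃ := by
    simp only [hN₃, hA₃, hN₂, hA₂, hD₁]; ring
  have key2 : (1 + a) * N₃ + 2 * A₃ * N₂ = 0 := by
    simp only [hN₃, hA₃, hN₂, hA₂, hD₁]; ring
  -- step 1: `z₁ = ι_m y`
  have hym : y - m = (a - 1) • m + w := by rw [hy, sub_smul, one_smul]; abel
  have hD₁eq : ‖y - m‖ ^ 2 = D₁ := by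
    rw [hym, show (a - 1) • m + w = (a - 1) • m + (1:ℝ) • w by rw [one_smul],
      norm_sq_lincomb hm hmw, ← ht, hD₁]
    ring
  have hD₁ne : D₁ ≠ 0 := by
    rw [← hD₁eq]; exact pow_ne_zero 2 (norm_ne_zero_iff.2 (sub_ne_zero.2 hy1))
  set z₁ := inversion m 1 y with hz₁
  have hz₁b : z₁ - (1 / 2 : ℝ) • m = (A₂ / (2 * D₁)) • m + (1 / D₁) • w := by
    rw [hz₁, inversion_eq_center_add, hD₁eq, hym, one_pow]
    match_scalars
    · field_simp; ring
    · field_simp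
  -- step 2: `z₂ = ι_{m/2,1/2} z₁`
  have hN₂eq : ‖z₁ - (1 / 2 : ℝ) • m‖ ^ 2 = N₂ / (4 * D₁ ^ 2) := by
    rw [hz₁b, norm_sq_lincomb hm hmw, ← ht, hN₂]
    field_simp
    ring
  have hz₁ne : z₁ - (1 / 2 : ℝ) • m ≠ 0 := sub_ne_zero.2 (inversion_unit_ne_half hm hy2)
  have hN₂ne : N₂ ≠ 0 := by
    intro h0
    have : ‖z₁ - (1 / 2 : ℝ) • m‖ ^ 2 = 0 := by rw [hN₂eq, h0, zero_div]
    exact hz₁ne (norm_eq_zero.1 (pow_eq_zero_iff two_ne_zero |>.1 this))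
  set z₂ := inversion ((1 / 2 : ℝ) • m) (1 / 2) z₁ with hz₂
  have hz₂m : z₂ - m = (A₃ / (2 * N₂)) • m + (D₁ / N₂) • w := by
    rw [hz₂, inversion_eq_center_add, hN₂eq, hz₁b]
    match_scalars <;> field_simp <;> ring
  -- step 3: `z₃ = ι_m z₂`
  have hN₃eq : ‖z₂ - m‖ ^ 2 = N₃ / (4 * N₂ ^ 2) := by
    rw [hz₂m, norm_sq_lincomb hm hmw, ← ht, hN₃]
    field_simp
    ring
  have hz₂ne : z₂ - m ≠ 0 := sub_ne_zero.2 (inversion_half_ne_center hm hy1)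
  have hN₃ne : N₃ ≠ 0 := by
    intro h0
    have : ‖z₂ - m‖ ^ 2 = 0 := by rw [hN₃eq, h0, zero_div]
    exact hz₂ne (norm_eq_zero.1 (pow_eq_zero_iff two_ne_zero |>.1 this))
  rw [inversion_eq_center_add, hN₃eq, hz₂m, hy, one_pow]
  -- the coefficient identities
  have c2 : (1 : ℝ) / (N₃ / (4 * N₂ ^ 2)) * (D₁ / N₂) = 1 := by
    field_simp
    linear_combination key1
  have c1 : (1 : ℝ) + 1 / (N₃ / (4 * N₂ ^ 2)) * (A₃ / (2 * N₂)) = a - 2 * a := by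
    field_simp
    linear_combination key2
  have e1 : (1 : ℝ) / (N₃ / (4 * N₂ ^ 2)) * (A₃ / (2 * N₂)) = -a - 1 := by linarith [c1]
  rw [smul_add, smul_smul, smul_smul, e1, c2, one_smul]
  module

end Summit.CriticalPhenomena.Ising3DConformalLimit.MoebiusLimitExistsNegative

end
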